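import Summits.QuantumFields.YangMills.Theorems.SoloBlindExpMoment
import Literature.MathematicalPhysics.QuantumFieldTheory.WilsonPlaquetteChessboardTail
import Literature.MathematicalPhysics.QuantumLattice.ContinuumLimitLGT
import Literature.MathematicalPhysics.QuantumLattice.LatticeGaugeDLRFreeEnergyProofs
import HarnessLib

/-!
# Chessboard exponential moments of one plaquette cost, uniformly over torus-limit states at weak coupling

Support file for the statement item `stmt-QuantumFields-12314`
(`Summit.QuantumFields.YangMills.Theses.DirichletWindow.LocalGaussianity`), line «exp-moment tangent law»
(reduction `Theorems/DirichletWindowLocalGaussianityExpMomentTangentLaw.lean`, input `ExpMomentBound`).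
Route-independent content (no `Theses` import):

* `ExpMoment.wilsonExpectation_exp_plaquetteCost_le_even` — EVEN tori `L ≥ 2`, `β ≥ 0`, `c ≥ 0`: for a plaquette
  `p = (x; 0, a)` of the reference orientation, `⟨exp(c φ_p)⟩_{Λ_L,β} ≤ exp(L⁻ᵈ (log Z_L(β − c) − log Z_L(β)))`,
  `φ_p = N − Re tr ρ(U_p)`: the Fröhlich–Israel–Lieb–Simon chessboard estimate for the full one-orientation array
  (`WilsonPlaquetteTail.integral_plaquette_le_rpow_sites`, [FILS78, Thm 4.1/4.3]) with `f = exp(c(N − Re tr ρ ·))`,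
  and the domination of the one-orientation energy by the Wilson action in the coupling-monotone form
  `SoloBlind.wilsonExpectation_expObs_le_exp`;
* `ExpMoment.wilsonExpectation_exp_plaquetteCost_le_all` — all tori `L ≥ 3` (odd ones by the tree's
  `SoloBlind.wilsonExpectation_exp_plaquetteCost_le`, [OS78]): the common bound
  `exp((4/L)ᵈ (log Z_L(β − c) − log Z_L(β)))`;
* `ExpMoment.eventually_wilsonExpectation_exp_le` — if the torus free energy density satisfies
  `f(β) + c₀ log β → K`, then for all large `β`, all large `L` and every site `x`,
  `⟨exp((β/2) φ_{(x;0,a)})⟩_{Λ_{L+1},β} ≤ exp(4ᵈ(c₀ log 2 + 1))` (`f(β/2) − f(β) → c₀ log 2`, existence of the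
  thermodynamic limit `exists_hasFreeEnergyDensity_holds`; template `SoloBlind.weakCoupling_plaquetteCost_sq_of_freeEnergyDensity`);
* `ExpMoment.integral_le_of_mem_limitPoints` — passage of a bound on a bounded continuous cylinder observable to every
  `μ ∈ infiniteVolumeLimitPoints ρ β`;
* `ExpMoment.expMoment_of_freeEnergy` — the assembled statement for a continuous unitary-type `ρ` in any dimension
  `d ≥ 2`: `∃ C β₁, ∀ β ≥ β₁, ∀ μ ∈ infiniteVolumeLimitPoints ρ β, ∀ x, ∫ exp((β/2)(N − Re tr ρ(U_{(x;0,a)}))) dμ ≤ C`,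
  GIVEN the free-energy asymptotics `f(β) + c₀ log β → K` (for compact simple `G` and faithful unitary `r` this is item
  8759 `FreeEnergyLogCoefficient`, `c₀ = 3 dim 𝔤_r / 2`, `d = 4`).

References: [FILS78] J. Fröhlich, R. Israel, E. H. Lieb, B. Simon, CMP 62 (1978) 1–34; [OS78] K. Osterwalder, E. Seiler,
Ann. Phys. 110 (1978) 440–471; S. Chatterjee, arXiv:1602.01222 Thm 2.1.  Everything here is an elementary consequence
([folklore]) of those tree theorems.  No rung or summit statement is proved here.
-/

noncomputable section

open MeasureTheory Filter Topology
open Literature.MathematicalPhysics.QuantumFieldTheory Literature.MathematicalPhysics.QuantumLattice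

namespace Summit.QuantumFields.YangMills.Theorems.LocalGaussianityExpMomentTangentLaw

namespace ExpMoment

/-! ### Finite volume -/

section FiniteVolume

variable {d L N : ℕ} [NeZero d] [NeZero L]
variable {G : Type*} [Group G] [TopologicalSpace G] [IsTopologicalGroup G] [CompactSpace G]
  [MeasurableSpace G] [BorelSpace G] [SecondCountableTopology G]
variable (ρ : G →* Matrix (Fin N) (Fin N) ℂ)

/-- **Exponential moment of one plaquette cost on EVEN tori** (`L ≥ 2` even, `β ≥ 0`, `c ≥ 0`, continuous `ρ` with
`Re tr ρ ≤ N`): for the plaquette `(x; 0, a)`, `a ≠ 0`,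
`⟨exp(c φ_{(x;0,a)})⟩_{Λ_L,β} ≤ exp(L⁻ᵈ (log Z_L(β − c) − log Z_L(β)))` — FILS chessboard for the full one-orientation
array + monotonicity in the coupling. [folklore] -/
theorem wilsonExpectation_exp_plaquetteCost_le_even [Fact (1 < L)] (hL : Even L) (hρ : Continuous ρ)
    (hρN : ∀ g, (ρ g).trace.re ≤ N) {β c : ℝ} (hβ : 0 ≤ β) (hc : 0 ≤ c) (x : Site d L) {a : Fin d}
    (ha : a ≠ 0) :
    wilsonExpectation ρ β (fun U : GaugeConfig d L G => Real.exp (c * SoloBlind.plaquetteCost ρ x 0 a U)) ≤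
      Real.exp ((1 : ℝ) / (L : ℝ) ^ d * (torusLogPartition d ρ (β - c) L - torusLogPartition d ρ β L)) := by
  haveI := isProbabilityMeasure_wilsonMeasure (d := d) (L := L) (G := G) ρ hρ β
  -- the one-plaquette observable `f(g) = exp(c (N − Re tr ρ g))`
  set f : G → ℝ := fun g => Real.exp (c * ((N : ℝ) - (ρ g).trace.re)) with hf
  have hf0 : ∀ g, 0 ≤ f g := fun g => (Real.exp_pos _).le
  have hfb : ∃ K : ℝ, ∀ g, |f g| ≤ K := by
    refine ⟨Real.exp (c * (2 * N)), fun g => ?_⟩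
    rw [abs_of_nonneg (hf0 g)]
    refine Real.exp_le_exp.2 (mul_le_mul_of_nonneg_left ?_ hc)
    have h := Literature.RepresentationTheory.CompactGroups.CompactGroup.abs_re_trace_le_card ρ hρ g
    simp only [Fintype.card_fin] at h
    linarith [(abs_le.1 h).1]
  have hfmeas : Measurable f := by
    refine (Real.continuous_exp.comp (continuous_const.mul (continuous_const.sub ?_))).measurable
    exact Complex.continuous_re.comp (Continuous.matrix_trace hρ)
  have hfm : ∀ (y : Site d L) (p q : Fin d),
      Measurable fun U : GaugeConfig d L G => f (plaquetteHolonomy U y p q) :=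
    fun y p q => hfmeas.comp (Literature.MathematicalPhysics.QuantumFieldTheory.measurable_plaquetteHolonomy y p q)
  have hconj : ∀ g h : G, f (h * g * h⁻¹) = f g := fun g h => by
    simp only [hf]
    rw [map_mul, map_mul, Matrix.trace_mul_cycle, ← map_mul, inv_mul_cancel, map_one, one_mul]
  have hinv : ∀ g : G, f g⁻¹ = f g := fun g => by
    simp only [hf]
    rw [Literature.RepresentationTheory.CompactGroups.CompactGroup.re_trace_map_inv ρ hρ]
  -- the full one-orientation array: `∏_c f(U_{(c;0,a)}) = SoloBlind.expObs ρ c A`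
  have h0a : (0 : Fin d) < a := (Fin.pos_iff_ne_zero' a).2 ha
  set A : Finset (Plaquette d L) :=
    (Finset.univ : Finset (Site d L)).image fun y => (y, ⟨((0 : Fin d), a), h0a⟩) with hA
  have hinj : Function.Injective fun y : Site d L => ((y, ⟨((0 : Fin d), a), h0a⟩) : Plaquette d L) :=
    fun y y' h => by simpa using congrArg Prod.fst h
  have hprod : ∀ U : GaugeConfig d L G,
      ∏ y : Site d L, f (plaquetteHolonomy U y 0 a) = SoloBlind.expObs ρ c A U := by
    intro U
    simp only [hf, SoloBlind.expObs, ← Real.exp_sum, ← Finset.mul_sum]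
    congr 1
    rw [hA, Finset.sum_image fun y _ y' _ h => hinj h]
    rfl
  -- the full-array integral is positive and bounded by `Z(β−c)/Z(β)`
  have hAint : Integrable (SoloBlind.expObs (G := G) ρ c A) (wilsonMeasure ρ β) := by
    refine Integrable.of_bound (C := Real.exp (c * (2 * N * A.card))) ?_ (ae_of_all _ fun U => ?_)
    · have hm : Measurable fun U : GaugeConfig d L G => ∏ y : Site d L, f (plaquetteHolonomy U y 0 a) :=
        Finset.measurable_prod _ fun y _ => hfm y 0 a
      rw [show (fun U : GaugeConfig d L G => ∏ y : Site d L, f (plaquetteHolonomy U y 0 a)) =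
        SoloBlind.expObs ρ c A from funext hprod] at hm
      exact hm.aestronglyMeasurable
    · rw [Real.norm_eq_abs, SoloBlind.expObs, abs_of_nonneg (Real.exp_pos _).le]
      refine Real.exp_le_exp.2 ?_
      rw [show c * (2 * (N : ℝ) * A.card) = c * (2 * N * A.card) from rfl]
      refine mul_le_mul_of_nonneg_left ?_ hc
      have hq : ∀ q ∈ A, SoloBlind.plaquetteCost ρ q.1 q.2.1.1 q.2.1.2 U ≤ 2 * N := fun q _ => by
        unfold SoloBlind.plaquetteCost
        have h := Literature.RepresentationTheory.CompactGroups.CompactGroup.abs_re_trace_le_card ρ hρ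
          (plaquetteHolonomy U q.1 q.2.1.1 q.2.1.2)
        simp only [Fintype.card_fin] at h
        linarith [(abs_le.1 h).1]
      calc ∑ q ∈ A, SoloBlind.plaquetteCost ρ q.1 q.2.1.1 q.2.1.2 U ≤ ∑ _q ∈ A, (2 * (N : ℝ)) :=
            Finset.sum_le_sum hq
        _ = 2 * N * A.card := by rw [Finset.sum_const, nsmul_eq_mul]; ring
  have hpos : 0 < ∫ U, ∏ y : Site d L, f (plaquetteHolonomy U y 0 a) ∂(wilsonMeasure ρ β) := by
    simp_rw [hprod]
    exact integral_exp_pos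
      (f := fun U => c * ∑ q ∈ A, SoloBlind.plaquetteCost ρ q.1 q.2.1.1 q.2.1.2 U) hAint
  have hfull : ∫ U, ∏ y : Site d L, f (plaquetteHolonomy U y 0 a) ∂(wilsonMeasure ρ β) ≤
      Real.exp (torusLogPartition d ρ (β - c) L - torusLogPartition d ρ β L) := by
    simp_rw [hprod]
    exact SoloBlind.wilsonExpectation_expObs_le_exp ρ hρ hρN hc β A
  -- the chessboard estimate
  have hcb := WilsonPlaquetteTail.integral_plaquette_le_rpow_sites ρ hL hρ hβ ha hf0 hfb hfm hconj hinv hpos x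
  have hexp : (0 : ℝ) ≤ (1 : ℝ) / (L : ℝ) ^ d := by positivity
  calc wilsonExpectation ρ β (fun U : GaugeConfig d L G => Real.exp (c * SoloBlind.plaquetteCost ρ x 0 a U))
      = ∫ U, f (plaquetteHolonomy U x 0 a) ∂(wilsonMeasure ρ β) := rfl
    _ ≤ (∫ U, ∏ y : Site d L, f (plaquetteHolonomy U y 0 a) ∂(wilsonMeasure ρ β)) ^ ((1 : ℝ) / (L : ℝ) ^ d) :=
        hcb
    _ ≤ (Real.exp (torusLogPartition d ρ (β - c) L - torusLogPartition d ρ β L)) ^ ((1 : ℝ) / (L : ℝ) ^ d) :=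
        Real.rpow_le_rpow hpos.le hfull hexp
    _ = _ := by rw [← Real.exp_mul, mul_comm]

/-- **Exponential moment of one plaquette cost on ALL tori `L ≥ 3`** (`β ≥ 0`, `c ≥ 0`, continuous `ρ` with
`Re tr ρ ≤ N`, plaquette `(x; 0, a)`, `a ≠ 0`): `⟨exp(c φ_{(x;0,a)})⟩_{Λ_L,β} ≤ exp((4/L)ᵈ (log Z_L(β − c) − log Z_L(β)))`
— even `L` by `wilsonExpectation_exp_plaquetteCost_le_even` (`L⁻ᵈ ≤ (4/L)ᵈ`, the exponent is non-negative), odd `L`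
by `SoloBlind.wilsonExpectation_exp_plaquetteCost_le`. [folklore] -/
theorem wilsonExpectation_exp_plaquetteCost_le_all (hL3 : 3 ≤ L) (hρ : Continuous ρ)
    (hρN : ∀ g, (ρ g).trace.re ≤ N) {β c : ℝ} (hβ : 0 ≤ β) (hc : 0 ≤ c) (x : Site d L) {a : Fin d}
    (ha : a ≠ 0) :
    wilsonExpectation ρ β (fun U : GaugeConfig d L G => Real.exp (c * SoloBlind.plaquetteCost ρ x 0 a U)) ≤
      Real.exp ((4 : ℝ) ^ d / (L : ℝ) ^ d *
        (torusLogPartition d ρ (β - c) L - torusLogPartition d ρ β L)) := by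
  rcases Nat.even_or_odd L with hE | hO
  · haveI : Fact (1 < L) := ⟨by omega⟩
    refine (wilsonExpectation_exp_plaquetteCost_le_even ρ hE hρ hρN hβ hc x ha).trans
      (Real.exp_le_exp.2 ?_)
    have hE0 := SoloBlind.torusLogPartition_sub_nonneg (d := d) (L := L) (G := G) ρ hρ (β := β) hc
    refine mul_le_mul_of_nonneg_right ?_ hE0
    have hL0 : (0 : ℝ) < (L : ℝ) ^ d := by positivity
    rw [div_le_div_iff_of_pos_right hL0]
    exact one_le_pow₀ (by norm_num)
  · have h0a : (0 : Fin d) < a := (Fin.pos_iff_ne_zero' a).2 ha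
    exact SoloBlind.wilsonExpectation_exp_plaquetteCost_le ρ hO hL3 hρ hβ hc
      ((x, ⟨((0 : Fin d), a), h0a⟩) : Plaquette d L)

/-! ### Weak coupling from the free-energy asymptotics -/

/-- **β-uniform exponential moments on all large tori from the free-energy asymptotics.**  If the torus free
energy density of the continuous model `ρ` (`Re tr ρ ≤ N`) satisfies `f(β) + c₀ log β → K`, then for all large `β`,
then all large `L`, every plaquette `(x; 0, a)` (`a ≠ 0`) of `(ℤ/(L+1)ℤ)ᵈ` has
`⟨exp((β/2) φ_{(x;0,a)})⟩_{Λ_{L+1},β} ≤ exp(4ᵈ (c₀ log 2 + 1))` (`f(β/2) − f(β) → c₀ log 2` and the thermodynamic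
limit `exists_hasFreeEnergyDensity_holds`). [folklore] -/
theorem eventually_wilsonExpectation_exp_le (hρ : Continuous ρ) (hρN : ∀ g, (ρ g).trace.re ≤ N)
    {c₀ K : ℝ} (hg : Tendsto (fun β : ℝ => freeEnergyDensity d ρ β + c₀ * Real.log β) atTop (𝓝 K))
    {a : Fin d} (ha : a ≠ 0) :
    ∀ᶠ β : ℝ in atTop, ∀ᶠ L : ℕ in atTop, ∀ x : Site d (L + 1),
      wilsonExpectation ρ β (fun U : GaugeConfig d (L + 1) G =>
          Real.exp (β / 2 * SoloBlind.plaquetteCost ρ x 0 a U)) ≤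
        Real.exp ((4 : ℝ) ^ d * (c₀ * Real.log 2 + 1)) := by
  -- `f(β/2) − f(β) → c₀ log 2`
  have hg2 : Tendsto (fun β : ℝ => freeEnergyDensity d ρ (β / 2) + c₀ * Real.log (β / 2)) atTop
      (𝓝 K) := hg.comp (tendsto_id.atTop_div_const (by norm_num : (0 : ℝ) < 2))
  have hdiff : Tendsto (fun β : ℝ => freeEnergyDensity d ρ (β / 2) - freeEnergyDensity d ρ β) atTop
      (𝓝 (c₀ * Real.log 2)) := by
    have h1 : Tendsto (fun β : ℝ => (freeEnergyDensity d ρ (β / 2) + c₀ * Real.log (β / 2)) -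
        (freeEnergyDensity d ρ β + c₀ * Real.log β) + c₀ * Real.log 2) atTop
        (𝓝 (K - K + c₀ * Real.log 2)) := (hg2.sub hg).add tendsto_const_nhds
    rw [sub_self, zero_add] at h1
    refine h1.congr' ?_
    filter_upwards [eventually_gt_atTop (0 : ℝ)] with β hβ
    rw [Real.log_div hβ.ne' (by norm_num)]
    ring
  have hev : ∀ᶠ β : ℝ in atTop, freeEnergyDensity d ρ (β / 2) - freeEnergyDensity d ρ β <
      c₀ * Real.log 2 + 1 / 2 :=
    hdiff.eventually (gt_mem_nhds (by linarith))
  filter_upwards [hev, eventually_ge_atTop (0 : ℝ)] with β hβ hβ0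
  -- finite-volume free energies at `β/2` and `β`
  have hf : ∀ b : ℝ,
      Tendsto (fun L : ℕ => (((L + 1 : ℕ) : ℝ) ^ d)⁻¹ * torusLogPartition d ρ b (L + 1))
        atTop (𝓝 (freeEnergyDensity d ρ b)) := fun b =>
    hasFreeEnergyDensity_freeEnergyDensity ρ (exists_hasFreeEnergyDensity_holds (d := d) ρ hρ b)
  have hfd : Tendsto (fun L : ℕ =>
      (((L + 1 : ℕ) : ℝ) ^ d)⁻¹ * torusLogPartition d ρ (β / 2) (L + 1) -
        (((L + 1 : ℕ) : ℝ) ^ d)⁻¹ * torusLogPartition d ρ β (L + 1)) atTop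
      (𝓝 (freeEnergyDensity d ρ (β / 2) - freeEnergyDensity d ρ β)) := (hf _).sub (hf _)
  have hevL : ∀ᶠ L : ℕ in atTop,
      (((L + 1 : ℕ) : ℝ) ^ d)⁻¹ * torusLogPartition d ρ (β / 2) (L + 1) -
        (((L + 1 : ℕ) : ℝ) ^ d)⁻¹ * torusLogPartition d ρ β (L + 1) < c₀ * Real.log 2 + 1 :=
    hfd.eventually (gt_mem_nhds (by linarith))
  filter_upwards [hevL, eventually_ge_atTop 2] with L hL hL2 x
  have h3 : 3 ≤ L + 1 := by omega
  have hmain := wilsonExpectation_exp_plaquetteCost_le_all (d := d) (L := L + 1) ρ h3 hρ hρN hβ0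
    (c := β / 2) (by linarith) x ha
  rw [show β - β / 2 = β / 2 by ring] at hmain
  refine hmain.trans (Real.exp_le_exp.2 ?_)
  have heq : (4 : ℝ) ^ d / ((L + 1 : ℕ) : ℝ) ^ d *
      (torusLogPartition d ρ (β / 2) (L + 1) - torusLogPartition d ρ β (L + 1)) =
      (4 : ℝ) ^ d * ((((L + 1 : ℕ) : ℝ) ^ d)⁻¹ * torusLogPartition d ρ (β / 2) (L + 1) -
        (((L + 1 : ℕ) : ℝ) ^ d)⁻¹ * torusLogPartition d ρ β (L + 1)) := by
    ring
  push_cast at heq ⊢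
  rw [heq]
  refine mul_le_mul_of_nonneg_left ?_ (by positivity)
  have := hL
  push_cast at this
  linarith

end FiniteVolume

/-! ### Passage to torus-limit states -/

section Limit

variable {d N : ℕ} [NeZero d]
variable {G : Type*} [Group G] [TopologicalSpace G] [IsTopologicalGroup G] [CompactSpace G]
  [MeasurableSpace G] [BorelSpace G]
variable (ρ : G →* Matrix (Fin N) (Fin N) ℂ)

omit [NeZero d] in
/-- **Bounds on torus expectations pass to torus-limit states**: if `F` is a bounded continuous cylinder observable
of `LGConfig d G` and the torus expectations `⟨F ∘ torusLift⟩_{Λ_{L+1},β}` are `≤ C` for all large `L`, then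
`∫ F dμ ≤ C` for every `μ ∈ infiniteVolumeLimitPoints ρ β`. [folklore] -/
theorem integral_le_of_mem_limitPoints {β C : ℝ} {F : LGConfig d G → ℝ} {S : Finset (Literature.MathematicalPhysics.QuantumLattice.ZdEdge d)}
    (hFS : IsCylinder F S) (hFc : Continuous F) (hFb : ∃ B, ∀ U, |F U| ≤ B)
    (hle : ∀ᶠ L : ℕ in atTop, wilsonExpectation (L := L + 1) ρ β (toTorusObservable (L + 1) F) ≤ C)
    {μ : Measure (LGConfig d G)} (hμ : μ ∈ infiniteVolumeLimitPoints (d := d) ρ β) :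
    ∫ U, F U ∂μ ≤ C := by
  obtain ⟨L, hL, hμL⟩ := hμ
  have hlim := hμL.2 F S hFS hFc hFb
  refine le_of_tendsto hlim ?_
  have hLk : Tendsto L atTop atTop := hL.tendsto_atTop
  exact (hLk.eventually hle)

end Limit

/-! ### The assembled statement -/

section Assembled

variable {d N : ℕ} [NeZero d]
variable {G : Type*} [Group G] [TopologicalSpace G] [IsTopologicalGroup G] [CompactSpace G]
  [MeasurableSpace G] [BorelSpace G] [SecondCountableTopology G]
variable (ρ : G →* Matrix (Fin N) (Fin N) ℂ)

omit [NeZero d] [CompactSpace G] [MeasurableSpace G] [BorelSpace G] [SecondCountableTopology G] in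
/-- The one-plaquette exponential observable `exp(c (N − Re tr ρ(U_{(x;i,j)})))` of `ℤᵈ` is a bounded continuous
cylinder function, and read on periodic configurations it is the torus observable `exp(c φ_{(x̄;i,j)})`. [folklore] -/
theorem expPlaquette_cylinder (hρ : Continuous ρ)
    (hρN' : ∀ g, -(N : ℝ) ≤ (ρ g).trace.re) (c : ℝ) (hc : 0 ≤ c)
    (x : Literature.Probability.LatticeModels.Site d) (i j : Fin d) (hij : i < j) :
    IsCylinder (fun U : LGConfig d G => Real.exp (c * ((N : ℝ) - plaquetteObs ρ x i j U)))
        (plaquetteEdges ((x, ⟨(i, j), hij⟩) : ZdPlaquette d)) ∧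
      Continuous (fun U : LGConfig d G => Real.exp (c * ((N : ℝ) - plaquetteObs ρ x i j U))) ∧
      (∃ B, ∀ U : LGConfig d G, |Real.exp (c * ((N : ℝ) - plaquetteObs ρ x i j U))| ≤ B) ∧
      ∀ M : ℕ, toTorusObservable M (fun U : LGConfig d G => Real.exp (c * ((N : ℝ) - plaquetteObs ρ x i j U))) =
        fun U : GaugeConfig d M G => Real.exp (c * SoloBlind.plaquetteCost ρ
          (Literature.Probability.LatticeModels.Torus.proj M x) i j U) := by
  refine ⟨?_, ?_, ?_, ?_⟩
  · intro U V h
    simp only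
    rw [isCylinder_plaquetteObs ρ ((x, ⟨(i, j), hij⟩) : ZdPlaquette d) h]
  · exact Real.continuous_exp.comp (continuous_const.mul (continuous_const.sub
      (continuous_plaquetteObs ρ hρ x i j)))
  · refine ⟨Real.exp (c * (2 * N)), fun U => ?_⟩
    rw [abs_of_nonneg (Real.exp_pos _).le]
    refine Real.exp_le_exp.2 (mul_le_mul_of_nonneg_left ?_ hc)
    unfold plaquetteObs
    linarith [hρN' (plaquetteHolonomyZd U x i j)]
  · intro M
    funext U
    simp only [toTorusObservable_apply, plaquetteObs, FreeEnergy.plaquetteHolonomyZd_torusLift,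
      SoloBlind.plaquetteCost]

/-- **Chessboard exponential moments, uniformly over torus-limit states at weak coupling.**  For a continuous
model `ρ : G →* M_N(ℂ)` of a second-countable compact group with `|Re tr ρ| ≤ N` whose torus free energy density
satisfies `f(β) + c₀ log β → K`: there are `C` and `β₁` such that for all `β ≥ β₁`, every
`μ ∈ infiniteVolumeLimitPoints ρ β` and every site `x`, `∫ exp((β/2)(N − Re tr ρ(U_{(x;0,a)}))) dμ ≤ C` (`a ≠ 0`).
[folklore] -/
theorem expMoment_of_freeEnergy (hρ : Continuous ρ) (hρN : ∀ g, (ρ g).trace.re ≤ N)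
    (hρN' : ∀ g, -(N : ℝ) ≤ (ρ g).trace.re)
    {c₀ K : ℝ} (hg : Tendsto (fun β : ℝ => freeEnergyDensity d ρ β + c₀ * Real.log β) atTop (𝓝 K))
    {a : Fin d} (ha : a ≠ 0) :
    ∃ C β₁ : ℝ, ∀ β : ℝ, β₁ ≤ β → ∀ μ ∈ infiniteVolumeLimitPoints (d := d) ρ β,
      ∀ x : Literature.Probability.LatticeModels.Site d,
        ∫ U, Real.exp (β / 2 * ((N : ℝ) - plaquetteObs ρ x 0 a U)) ∂μ ≤ C := by
  have h0a : (0 : Fin d) < a := (Fin.pos_iff_ne_zero' a).2 ha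
  obtain ⟨β₁, hβ₁⟩ := eventually_atTop.1
    ((eventually_wilsonExpectation_exp_le (d := d) ρ hρ hρN hg ha).and (eventually_ge_atTop (0 : ℝ)))
  refine ⟨Real.exp ((4 : ℝ) ^ d * (c₀ * Real.log 2 + 1)), β₁, fun β hβ μ hμ x => ?_⟩
  obtain ⟨hL, hβ0⟩ := hβ₁ β hβ
  obtain ⟨hcyl, hcont, hbdd, htorus⟩ :=
    expPlaquette_cylinder (d := d) ρ hρ hρN' (β / 2) (by linarith) x 0 a h0a
  refine integral_le_of_mem_limitPoints ρ hcyl hcont hbdd ?_ hμ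
  filter_upwards [hL] with L hLx
  rw [htorus (L + 1)]
  exact hLx _

end Assembled

end ExpMoment

end Summit.QuantumFields.YangMills.Theorems.LocalGaussianityExpMomentTangentLaw

end
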